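import Literature.AlgebraicGeometry.Frobenioids.MonoidFunctors
import HarnessLib

/-!
# [FrdI] §0: the perfection of a product monoid — `(M × N)^pf ≃ M^pf × N^pf`

Mochizuki, *The geometry of Frobenioids I: the general theory*, Kyushu J. Math. **62** (2008)
293–400, §0 "Monoids", kurims text p. 11 [cite: MochizukiFrdI2008, §0 p.11]: "`M^pf := lim_→ M`",
the inductive limit of the system `… → M —(n·)→ M → …` indexed by `(ℕ_{≥1}, ∣)` (`Perfection M`,
`Monoids.lean`).  A filtered colimit commutes with finite products; for the perfection this is the
explicit isomorphism `(a, b)^{1/n} ↦ (a^{1/n}, b^{1/n})` with inverse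
`(a^{1/n}, b^{1/m}) ↦ (a^m, b^n)^{1/(nm)}` constructed here.

Used by [FrdII] Thm. 3.6 (i) (kurims p. 36): the rational function monoid of `C^ℚ = C^pf` is
"`(Φ^fld)^ℚ := (Φ^fld)^pf`" with `Φ^fld := Φ^gp × Φ^∡` a PRODUCT monoid on `D`
(`ArchFrd.fieldMonoid`, `ArchimedeanUnitMonoids.lean`), so that `(Φ^fld)^pf(A) ≃ Φ^gp(A)^pf × Φ^∡(A)^pf`
objectwise [cite: MochizukiFrdII2008, Thm 3.6 (i) p.36] (abc-iut cell, layer L1, row M13-c3, piece P2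
FILE B of HOME/staging/L1/L1-t6/g3/M13-c3-DESIGN.md; general monoid algebra supplied by abc-iut-w5-d194).

Contents (classical monoid algebra; nothing here is specific to the abc programme or takes a side on
[IUTchIII] Cor. 3.12):
* `Perfection.toProd : (M × N)^pf →* M^pf × N^pf`, `toProd_mk`, `toProd_of`;
* `toProd_injective`, `toProd_surjective`, **`Perfection.prodMulEquiv : (M × N)^pf ≃* M^pf × N^pf`**,
  `prodMulEquiv_mk`, `prodMulEquiv_symm_mk`, `prodMulEquiv_of`, `prodMulEquiv_symm_of`;
* same-universe compatibilities with `Perfection.map`: `toProd_apply_eq` (the components are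
  `map fst`, `map snd`) and `toProd_map_prodMap` (naturality in `(M, N)`).
-/

namespace Literature.AlgebraicGeometry.Frobenioids

namespace Perfection

open Function

universe u v u' v' w

section General

variable {M : Type u} {N : Type v} [CommMonoid M] [CommMonoid N]

/-- Exponent bookkeeping: from `a ^ p = b ^ q` to `a ^ (k p) = b ^ (k q)`. [folklore] -/
private theorem pow_eq_pow_mul_left {P : Type u'} [Monoid P] {a b : P} {p q : ℕ} (h : a ^ p = b ^ q)
    (k : ℕ) : a ^ (k * p) = b ^ (k * q) := by
  rw [mul_comm k p, mul_comm k q, pow_mul, pow_mul, h]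

/-- The comparison map `(M × N)^pf → M^pf × N^pf`, `(a, b)^{1/n} ↦ (a^{1/n}, b^{1/n})` (the two
projections `M × N → M`, `N` perfected; FrdI §0 p. 11, functoriality of `(-)^pf`).
[cite: MochizukiFrdI2008, §0 p.11] -/
def toProd : Perfection (M × N) →* Perfection M × Perfection N where
  toFun := Quotient.lift (fun x : (M × N) × ℕ+ => (mk x.1.1 x.2, mk x.1.2 x.2)) (by
    rintro ⟨⟨a, b⟩, n⟩ ⟨⟨a', b'⟩, n'⟩ ⟨K, h⟩
    have h1 : a ^ ((K : ℕ) * (n' : ℕ)) = a' ^ ((K : ℕ) * (n : ℕ)) := congrArg Prod.fst h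
    have h2 : b ^ ((K : ℕ) * (n' : ℕ)) = b' ^ ((K : ℕ) * (n : ℕ)) := congrArg Prod.snd h
    exact Prod.ext (mk_eq_mk_iff.mpr ⟨K, h1⟩) (mk_eq_mk_iff.mpr ⟨K, h2⟩))
  map_one' := rfl
  map_mul' x y := by
    obtain ⟨⟨⟨a, b⟩, n⟩, rfl⟩ := mk_surjective x
    obtain ⟨⟨⟨c, d⟩, m⟩, rfl⟩ := mk_surjective y
    rfl

/-- `toProd` on classes. [cite: MochizukiFrdI2008, §0 p.11] -/
@[simp] theorem toProd_mk (a : M) (b : N) (n : ℕ+) : toProd (mk (a, b) n) = (mk a n, mk b n) := rfl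

/-- `toProd` on `M × N ⊆ (M × N)^pf`. [cite: MochizukiFrdI2008, §0 p.11] -/
@[simp] theorem toProd_of (a : M) (b : N) : toProd (of (M × N) (a, b)) = (of M a, of N b) := rfl

/-- `toProd` is injective: if `a^{1/n} = a'^{1/n'}` and `b^{1/n} = b'^{1/n'}` then
`(a, b)^{1/n} = (a', b')^{1/n'}` (take a common exponent witness). [cite: MochizukiFrdI2008, §0 p.11] -/
theorem toProd_injective : Injective (toProd (M := M) (N := N)) := by
  intro x y hxy
  obtain ⟨⟨⟨a, b⟩, n⟩, rfl⟩ := mk_surjective x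
  obtain ⟨⟨⟨a', b'⟩, n'⟩, rfl⟩ := mk_surjective y
  dsimp only at hxy ⊢
  rw [toProd_mk, toProd_mk, Prod.mk.injEq, mk_eq_mk_iff, mk_eq_mk_iff] at hxy
  obtain ⟨⟨K, hK⟩, ⟨K', hK'⟩⟩ := hxy
  refine mk_eq_mk_iff.mpr ⟨K * K', Prod.ext ?_ ?_⟩
  · show a ^ ((K * K' : ℕ+) * n' : ℕ) = a' ^ ((K * K' : ℕ+) * n : ℕ)
    have e := pow_eq_pow_mul_left hK (K' : ℕ)
    rw [PNat.mul_coe, show (K : ℕ) * (K' : ℕ) * (n' : ℕ) = (K' : ℕ) * ((K : ℕ) * (n' : ℕ)) by ring,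
      show (K : ℕ) * (K' : ℕ) * (n : ℕ) = (K' : ℕ) * ((K : ℕ) * (n : ℕ)) by ring, e]
  · show b ^ ((K * K' : ℕ+) * n' : ℕ) = b' ^ ((K * K' : ℕ+) * n : ℕ)
    have e := pow_eq_pow_mul_left hK' (K : ℕ)
    rw [PNat.mul_coe, show (K : ℕ) * (K' : ℕ) * (n' : ℕ) = (K : ℕ) * ((K' : ℕ) * (n' : ℕ)) by ring,
      show (K : ℕ) * (K' : ℕ) * (n : ℕ) = (K : ℕ) * ((K' : ℕ) * (n : ℕ)) by ring, e]

/-- `toProd` is surjective: `(a^{1/n}, b^{1/m})` is the image of `(a^m, b^n)^{1/(nm)}`.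
[cite: MochizukiFrdI2008, §0 p.11] -/
theorem toProd_surjective : Surjective (toProd (M := M) (N := N)) := by
  rintro ⟨x, y⟩
  obtain ⟨⟨a, n⟩, rfl⟩ := mk_surjective x
  obtain ⟨⟨b, m⟩, rfl⟩ := mk_surjective y
  refine ⟨mk (a ^ (m : ℕ), b ^ (n : ℕ)) (n * m), ?_⟩
  dsimp only
  rw [toProd_mk, mk_pow_mul a n m, mul_comm n m, mk_pow_mul b m n]

/-- `toProd` is bijective. [cite: MochizukiFrdI2008, §0 p.11] -/
theorem toProd_bijective : Bijective (toProd (M := M) (N := N)) :=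
  ⟨toProd_injective, toProd_surjective⟩

/-- **The perfection of a product**: `(M × N)^pf ≃* M^pf × N^pf` (the filtered colimit `lim_→`
along `(ℕ_{≥1}, ∣)` commutes with the binary product). [cite: MochizukiFrdI2008, §0 p.11] -/
noncomputable def prodMulEquiv : Perfection (M × N) ≃* Perfection M × Perfection N :=
  MulEquiv.ofBijective toProd toProd_bijective

/-- `prodMulEquiv` is `toProd`. [cite: MochizukiFrdI2008, §0 p.11] -/
@[simp] theorem prodMulEquiv_apply (x : Perfection (M × N)) : prodMulEquiv x = toProd x := rfl

/-- `prodMulEquiv` on classes. [cite: MochizukiFrdI2008, §0 p.11] -/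
theorem prodMulEquiv_mk (a : M) (b : N) (n : ℕ+) : prodMulEquiv (mk (a, b) n) = (mk a n, mk b n) := rfl

/-- `prodMulEquiv` on `M × N ⊆ (M × N)^pf`. [cite: MochizukiFrdI2008, §0 p.11] -/
theorem prodMulEquiv_of (a : M) (b : N) : prodMulEquiv (of (M × N) (a, b)) = (of M a, of N b) := rfl

/-- The inverse of `prodMulEquiv` on classes: `(a^{1/n}, b^{1/m}) ↦ (a^m, b^n)^{1/(nm)}`.
[cite: MochizukiFrdI2008, §0 p.11] -/
theorem prodMulEquiv_symm_mk (a : M) (b : N) (n m : ℕ+) :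
    prodMulEquiv.symm (mk a n, mk b m) = mk (a ^ (m : ℕ), b ^ (n : ℕ)) (n * m) := by
  apply prodMulEquiv.injective
  rw [MulEquiv.apply_symm_apply, prodMulEquiv_mk, mk_pow_mul a n m, mul_comm n m, mk_pow_mul b m n]

/-- The inverse of `prodMulEquiv` on `M × N`: `(a, b) ↦ (a, b)`. [cite: MochizukiFrdI2008, §0 p.11] -/
@[simp] theorem prodMulEquiv_symm_of (a : M) (b : N) :
    prodMulEquiv.symm (of M a, of N b) = of (M × N) (a, b) := by
  apply prodMulEquiv.injective
  rw [MulEquiv.apply_symm_apply, prodMulEquiv_of]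

/-- First component of the inverse followed by `toProd`. [cite: MochizukiFrdI2008, §0 p.11] -/
@[simp] theorem toProd_symm_apply (z : Perfection M × Perfection N) : toProd (prodMulEquiv.symm z) = z :=
  prodMulEquiv.apply_symm_apply z

end General

section SameUniverse

variable {M N M' N' : Type w} [CommMonoid M] [CommMonoid N] [CommMonoid M'] [CommMonoid N']

/-- The components of `toProd` are the perfected projections `(fst)^pf`, `(snd)^pf`.
[cite: MochizukiFrdI2008, §0 p.11] -/
theorem toProd_apply_eq (x : Perfection (M × N)) :
    toProd x = (map (MonoidHom.fst M N) x, map (MonoidHom.snd M N) x) := by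
  obtain ⟨⟨⟨a, b⟩, n⟩, rfl⟩ := mk_surjective x
  rfl

/-- Naturality of `toProd` in the pair `(M, N)`: `toProd ∘ (f × g)^pf = (f^pf × g^pf) ∘ toProd`.
[cite: MochizukiFrdI2008, §0 p.11] -/
theorem toProd_map_prodMap (f : M →* M') (g : N →* N') (x : Perfection (M × N)) :
    toProd (map (f.prodMap g) x) = Prod.map (map f) (map g) (toProd x) := by
  obtain ⟨⟨⟨a, b⟩, n⟩, rfl⟩ := mk_surjective x
  rfl

/-- Naturality of `prodMulEquiv` in the pair `(M, N)`. [cite: MochizukiFrdI2008, §0 p.11] -/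
theorem prodMulEquiv_map_prodMap (f : M →* M') (g : N →* N') (x : Perfection (M × N)) :
    prodMulEquiv (map (f.prodMap g) x) = Prod.map (map f) (map g) (prodMulEquiv x) :=
  toProd_map_prodMap f g x

/-- Naturality of the inverse: `(f × g)^pf ∘ prodMulEquiv⁻¹ = prodMulEquiv⁻¹ ∘ (f^pf × g^pf)`.
[cite: MochizukiFrdI2008, §0 p.11] -/
theorem map_prodMap_symm (f : M →* M') (g : N →* N') (z : Perfection M × Perfection N) :
    map (f.prodMap g) (prodMulEquiv.symm z) = prodMulEquiv.symm (Prod.map (map f) (map g) z) := by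
  apply prodMulEquiv.injective
  rw [prodMulEquiv_map_prodMap, MulEquiv.apply_symm_apply, MulEquiv.apply_symm_apply]

end SameUniverse

end Perfection

end Literature.AlgebraicGeometry.Frobenioids
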